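import Mathlib
import Literature.Computability.AlgebraicComplexity.HessianAtOrigin
import Literature.Computability.AlgebraicComplexity.LandsbergRessayreNormalForm
import Literature.Computability.AlgebraicComplexity.LRPencilOfMatrix
import Summits.ValiantsHypothesis.ValiantsHypothesis.Theorems.RefutationDegreeBeyondHessianNsStubConjTransl
import Summits.ValiantsHypothesis.ValiantsHypothesis.Theorems.RefutationDegreeMrCalibrationMinors

/-!
# Landsberg–Ressayre normal form of a corank-one affine pencil (crux `BeyondHessianNs`)

Helper file for crux item stmt-ValiantsHypothesis-5641 (`RefutationDegree.BeyondHessianNs`),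
stub `stub_normalFormOfCorankOne` of the line `Sketch`.

Let `A` be a square matrix of AFFINE linear forms (entries of total degree `≤ 1`) over a field `K`
and `y` a point at which the value `A(y)` has corank EXACTLY one (`det A(y) = 0`,
`adj A(y) ≠ 0`).  Then for ANY prescribed index `i₀` there are constant matrices `Z_e` with

`det A(X + y) = det (Λ_{i₀} + Σ_e X_e Z_e)`,

where `Λ_{i₀} = lamMatrix K i₀` is the diagonal matrix with `0` at `i₀` and `1` elsewhere
(Landsberg–Ressayre 2017, §3.3) and `A(X + y)` is the translate (`transl y`).

Proof.
* `rank A(y) = m - 1`: `<  m` because `det A(y) = 0` (`Matrix.rank_lt_card_of_det_eq_zero`),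
  `≥ m - 1` because a non-zero adjugate entry is, up to sign, a non-zero `(m-1) × (m-1)` minor
  (`Matrix.adjugate_fin_succ_eq_det_submatrix`), while all such minors of a matrix of rank
  `< m - 1` vanish (`RefutationDegreeMrCalibration.det_submatrix_eq_zero_of_rank_lt`);
* `V A(y) U = Λ_{i'}` for invertible `V, U` and SOME `i'` (`exists_mul_mul_eq_lamMatrix`);
  permuting rows of `V` and columns of `U` by the transposition `swap i₀ i'` gives `Λ_{i₀}`
  (`Matrix.submatrix_mul`, `Matrix.det_permute`), and rescaling the row `i₀` of `V` (which does not
  change `Λ_{i₀}`, whose row `i₀` is zero) achieves `det V · det U = 1`;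
* `B := V · A(X + y) · U` is affine with `det B = det A(X + y)` and constant part `Λ_{i₀}`
  (`stub_conj_transl`), and `B = B(0) + Σ_e X_e B_e` with `B_e = coeffMat B e`
  (`LRPencil.eq_affine_of_totalDegree_le_one`); take `Z_e := B_e`.
-/

noncomputable section

-- single-conjunct layout: Sub = Summit, duplicated namespace component intended
set_option linter.dupNamespace false

namespace Summit.ValiantsHypothesis.ValiantsHypothesis.Theorems.RefutationDegreeBeyondHessianNs

open MvPolynomial Matrix
open Literature.Computability.AlgebraicComplexity

section RankOfCorankOne

variable {K : Type*} [Field K]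

/-- If the adjugate of an `(m+1) × (m+1)` matrix over a field is non-zero, the matrix has rank
`≥ m`: a non-zero adjugate entry is `±` an `m × m` minor, and all `m × m` minors of a matrix of
rank `< m` vanish. [folklore] -/
theorem le_rank_of_adjugate_ne_zero {m : ℕ} (M : Matrix (Fin (m + 1)) (Fin (m + 1)) K)
    (hM : M.adjugate ≠ 0) : m ≤ M.rank := by
  by_contra h
  rw [not_le] at h
  apply hM
  ext i j
  rw [Matrix.adjugate_fin_succ_eq_det_submatrix, Matrix.zero_apply,
    RefutationDegreeMrCalibration.det_submatrix_eq_zero_of_rank_lt M h, mul_zero]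

/-- A square matrix over a field with `det = 0` and non-zero adjugate has corank exactly one:
`rank = card - 1`. [folklore] -/
theorem rank_eq_card_sub_one_of_adjugate_ne_zero {m : ℕ} (M : Matrix (Fin m) (Fin m) K)
    (hdet : M.det = 0) (hM : M.adjugate ≠ 0) : M.rank = Fintype.card (Fin m) - 1 := by
  cases m with
  | zero => exact absurd (Subsingleton.elim _ _) hM
  | succ m =>
    have h1 := Matrix.rank_lt_card_of_det_eq_zero hdet
    have h2 := le_rank_of_adjugate_ne_zero M hM
    rw [Fintype.card_fin] at h1 ⊢
    omega

end RankOfCorankOne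

section NormalFormAt

variable {K : Type*} [Field K] {ι : Type*} [DecidableEq ι]

/-- Conjugating `Λ_{i'}` by the transposition `(i₀ i')` gives `Λ_{i₀}`. [folklore] -/
theorem lamMatrix_submatrix_swap (i₀ i' : ι) :
    (lamMatrix K i').submatrix (Equiv.swap i₀ i') (Equiv.swap i₀ i') = lamMatrix K i₀ := by
  rw [lamMatrix, lamMatrix, Matrix.submatrix_diagonal_equiv]
  congr 1
  funext i
  simp only [Function.comp_apply, Equiv.swap_apply_eq_iff, Equiv.swap_apply_right]

variable [Fintype ι]

/-- Rescaling the row `i₀` does not change `Λ_{i₀}` (that row is zero). [folklore] -/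
theorem diagonal_mul_lamMatrix (i₀ : ι) (c : K) :
    Matrix.diagonal (fun i => if i = i₀ then c else 1) * lamMatrix K i₀ = lamMatrix K i₀ := by
  rw [lamMatrix, Matrix.diagonal_mul_diagonal]
  congr 1
  funext i
  by_cases hi : i = i₀ <;> simp [hi]

/-- The determinant of the rescaling matrix. [folklore] -/
theorem det_diagonal_ite (i₀ : ι) (c : K) :
    (Matrix.diagonal (fun i => if i = i₀ then c else (1 : K))).det = c := by
  rw [Matrix.det_diagonal, Finset.prod_ite_eq', if_pos (Finset.mem_univ _)]

/-- The normal form `V Λ U = Λ_{i₀}` of a matrix of rank `card - 1` (LR17 §3.3,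
`exists_mul_mul_eq_lamMatrix`) can be achieved for ANY prescribed index `i₀`, with `V`, `U` of
non-zero determinant: permute by the transposition `(i₀ i')`. [folklore] -/
theorem exists_mul_mul_eq_lamMatrix_at (Λ : Matrix ι ι K) (hΛ : Λ.rank = Fintype.card ι - 1)
    (i₀ : ι) : ∃ V U : Matrix ι ι K, V.det * U.det ≠ 0 ∧ V * Λ * U = lamMatrix K i₀ := by
  have hι : 0 < Fintype.card ι := Fintype.card_pos_iff.mpr ⟨i₀⟩
  obtain ⟨V, U, i', hV, hU, hVU⟩ := exists_mul_mul_eq_lamMatrix Λ hΛ hι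
  refine ⟨V.submatrix (Equiv.swap i₀ i') id, U.submatrix id (Equiv.swap i₀ i'), ?_, ?_⟩
  · have hV' := ((Matrix.isUnit_iff_isUnit_det V).mp hV).ne_zero
    have hU' := ((Matrix.isUnit_iff_isUnit_det U).mp hU).ne_zero
    rw [Matrix.det_permute, Matrix.det_permute']
    rcases Int.units_eq_one_or (Equiv.Perm.sign (Equiv.swap i₀ i')) with h | h <;>
      simp [h, hV', hU']
  · rw [← lamMatrix_submatrix_swap i₀ i', ← hVU,
      Matrix.submatrix_mul _ _ _ id _ Function.bijective_id,
      Matrix.submatrix_mul _ _ _ id _ Function.bijective_id, Matrix.submatrix_id_id]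

/-- Normal form with normalised determinants: if `rank Λ = card - 1` then for any `i₀` there are
`V`, `U` with `V Λ U = Λ_{i₀}` and `det V · det U = 1` (rescale the row `i₀` of `V`). [folklore] -/
theorem exists_mul_mul_eq_lamMatrix_at_det_one (Λ : Matrix ι ι K)
    (hΛ : Λ.rank = Fintype.card ι - 1) (i₀ : ι) :
    ∃ V U : Matrix ι ι K, V * Λ * U = lamMatrix K i₀ ∧ V.det * U.det = 1 := by
  obtain ⟨V, U, hd, hVU⟩ := exists_mul_mul_eq_lamMatrix_at Λ hΛ i₀
  refine ⟨Matrix.diagonal (fun i => if i = i₀ then (V.det * U.det)⁻¹ else 1) * V, U, ?_, ?_⟩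
  · rw [Matrix.mul_assoc, Matrix.mul_assoc, ← Matrix.mul_assoc V, hVU, diagonal_mul_lamMatrix]
  · rw [Matrix.det_mul, det_diagonal_ite, mul_assoc, inv_mul_cancel₀ hd]

end NormalFormAt

section AffineDecomposition

variable {K : Type*} [CommRing K] {ι : Type*} [Fintype ι] {o : Type*}

/-- The affine decomposition of a matrix of affine linear forms at the polynomial level:
`B = B(0) + Σ_e X_e • B_e` with `B(0) = constPart B` and `B_e = coeffMat B e`
(entrywise `LRPencil.eq_affine_of_totalDegree_le_one`). [folklore] -/
theorem eq_constPart_add_sum_coeffMat (B : Matrix o o (MvPolynomial ι K))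
    (hB : ∀ i j, (B i j).totalDegree ≤ 1) :
    B = (constPart B).map (C : K →+* MvPolynomial ι K) +
      ∑ e : ι, (X e : MvPolynomial ι K) •
        (LRPencil.coeffMat B e).map (C : K →+* MvPolynomial ι K) := by
  refine Matrix.ext fun i j => ?_
  conv_lhs => rw [LRPencil.eq_affine_of_totalDegree_le_one (B i j) (hB i j)]
  simp only [Matrix.add_apply, Matrix.sum_apply, Matrix.smul_apply, Matrix.map_apply,
    constPart_apply, LRPencil.coeffMat_apply, smul_eq_mul, constantCoeff_eq]
  congr 1
  exact Finset.sum_congr rfl fun e _ => mul_comm _ _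

end AffineDecomposition

/-- **Landsberg–Ressayre normal form of a corank-one affine pencil** (stub
`stub_normalFormOfCorankOne` of the line `Sketch`): if `A` is a square matrix of affine linear
forms whose value `A(y)` has corank exactly one (`det A(y) = 0`, `adj A(y) ≠ 0`), then for every
index `i₀` there are constant matrices `Z_e` with `det A(X + y) = det (Λ_{i₀} + Σ_e X_e Z_e)`.
[cite: LandsbergRessayre2017, §3.3] -/
theorem stub_normalFormOfCorankOne : ∀ (K : Type) [Field K] (n m : ℕ) (i₀ : Fin m)
    (y : Fin n × Fin n → K) (A : Matrix (Fin m) (Fin m) (MvPolynomial (Fin n × Fin n) K)),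
    (∀ i j, (A i j).totalDegree ≤ 1) → MvPolynomial.eval y A.det = 0 →
      (A.map (MvPolynomial.eval y)).adjugate ≠ 0 →
        ∃ Z : Fin n × Fin n → Matrix (Fin m) (Fin m) K,
          Literature.Computability.AlgebraicComplexity.transl y A.det =
            ((Literature.Computability.AlgebraicComplexity.lamMatrix K i₀).map MvPolynomial.C +
              ∑ e : Fin n × Fin n, (MvPolynomial.X e : MvPolynomial (Fin n × Fin n) K) •
                (Z e).map (MvPolynomial.C : K →+* MvPolynomial (Fin n × Fin n) K) :
                Matrix (Fin m) (Fin m) (MvPolynomial (Fin n × Fin n) K)).det := by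
  intro K _ n m i₀ y A hA hdet hadj
  -- (1) the value `A(y)` has rank `m - 1`
  have hMdet : (A.map (MvPolynomial.eval y)).det = 0 := by
    rw [← RingHom.mapMatrix_apply, ← RingHom.map_det]; exact hdet
  have hrank := rank_eq_card_sub_one_of_adjugate_ne_zero _ hMdet hadj
  -- (2)-(4) normal form at the prescribed index with normalised determinants
  obtain ⟨V, U, hVU, hVU1⟩ := exists_mul_mul_eq_lamMatrix_at_det_one _ hrank i₀
  -- (5) conjugate the translate
  obtain ⟨hBdeg, hBdet, hBconst, -⟩ := stub_conj_transl A hA y V U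
  set B : Matrix (Fin m) (Fin m) (MvPolynomial (Fin n × Fin n) K) :=
    V.map (C : K →+* MvPolynomial (Fin n × Fin n) K) * A.map (transl y) *
      U.map (C : K →+* MvPolynomial (Fin n × Fin n) K) with hB
  -- (6) affine decomposition of `B`
  refine ⟨LRPencil.coeffMat B, ?_⟩
  rw [← hVU, ← hBconst, ← eq_constPart_add_sum_coeffMat B hBdeg, hBdet, hVU1, map_one, one_mul]

end Summit.ValiantsHypothesis.ValiantsHypothesis.Theorems.RefutationDegreeBeyondHessianNs
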